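import Summits.ResolutionOfSingularities.ResolutionOfSingularities.Theses.Descent
import Summits.ResolutionOfSingularities.ResolutionOfSingularities.Theses.WeightedInvariant
import Summits.ResolutionOfSingularities.ResolutionOfSingularities.Theorems.WeightedInvariantDescentPerfectToAllPerfectBaseResolution
import Summits.ResolutionOfSingularities.ResolutionOfSingularities.Theorems.WeightedInvariantDescentPerfectToAllDescendResolutionData
import Summits.ResolutionOfSingularities.ResolutionOfSingularities.Theorems.WeightedInvariantDescentPerfectToAllDescendResolutionProps
import Summits.ResolutionOfSingularities.ResolutionOfSingularities.Theorems.WeightedInvariantDescentPerfectToAllTowerInduction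
import Summits.ResolutionOfSingularities.ResolutionOfSingularities.Theorems.WeightedInvariantDescentPerfectToAllKummerCriterion
import Summits.ResolutionOfSingularities.ResolutionOfSingularities.Theorems.WeightedInvariantDescentPerfectToAllConstantQuotientRegular
import Summits.ResolutionOfSingularities.ResolutionOfSingularities.Theorems.WeightedInvariantDescentPerfectToAllOneRootReduceToIntegral
import Summits.ResolutionOfSingularities.ResolutionOfSingularities.Theorems.WeightedInvariantDescentPerfectToAllOneRootReduceToGeomIntegral
import Summits.ResolutionOfSingularities.ResolutionOfSingularities.Theorems.WeightedInvariantDescentPerfectToAllOneRootNormalization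

/-!
# Crux `DescentPerfectToAll` (stmt-ResolutionOfSingularities-0549) — line `root-of-a-constant`

SKELETON v8 (line lead c8, prover-line-stmt-ResolutionOfSingularities-0549-c8-0, 2026-08-16): byte-identical to v7 below this
docstring; re-registered by c8 after re-checking on the farm (rc 0, 1 sorry). The c8 independent pass
(`Cruxes/DescentPerfectToAll/NegativeNotes-independent-pass-c8.md`) reformulates the one open stub F″ as reduction of
singularities of the arithmetic rank-1 p-closed foliation `sat(∂/∂α)` on a SMOOTH K-model sandwiched `Y' → X̃ → W` between two
smooth varieties (W smooth over k), i.e. a vector-field resolution problem open from `dim X = 4`; no reshape of the stub set follows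
from it (any split would hide that problem in one stub), so the register is unchanged.

SKELETON v7 (line lead c7, prover-line-stmt-ResolutionOfSingularities-0549-c7-0, 2026-08-16): tree v6 (RESHAPE 2) with the
LANDED tool stub R3 `stub_oneRootNormalization` now IMPORTED from its accepted module (p112741) instead of re-sorried;
exactly ONE `sorry` remains — F″ `stub_oneRootStepCoreNormal`, which is crux-complete (compositions for WeightedInvariant and
Descent by name; the rfl-equal UniformComplexity copy is noted at the end)
(`Theorems/WeightedInvariantDescentPerfectToAllOneRootCoreReduction.lean`: crux ⟺ F′ = R3 ∘ F″) and is the constant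
degree-`p` case of Picover's radicial bottom (`Theorems/WeightedInvariantDescentPerfectToAllPicoverLink.lean`:
`Picover → DescentPerfectToAll`; `Theorems/PAlterationPalterationThesisPerfectTransfer.lean`:
`descentPerfectToAll_iff_picover_of_perfectRes`).

LEAD SKELETON (prover-line-stmt-ResolutionOfSingularities-0549-c1-0, 2026-08-16), rebuilt from the card
`Cruxes/DescentPerfectToAll/Ideas/root-of-a-constant.md` and the stub NAMES the crux-plan seat registered
(A `stub_perfectClosureDescent`, B `stub_rootTowerReduction`, C `stub_inertRootStep`, D `stub_kummerCriterion`,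
E `stub_constantQuotientRegular`, F `stub_kummerRootStep`); the planner's own `Lines/root-of-a-constant.lean`
never reached the tree (`crux write` refused for that seat) and the evidence store is not mounted in this jail,
so the composition is re-derived in the TREE's vocabulary (Mathlib `perfectClosure`, `IntermediateField`,
`IsPurelyInseparable`, `IsPullback`; in-tree `Literature.AlgebraicGeometry.Resolution.FiniteSubextensionDescent`).

The crux: `∀ p prime, PerfectRes p → ResolutionInChar.{0} p`. Composition (`DescentPerfectToAll_of`):

1. `stub_perfectBaseResolution` (A₁, antecedent consumer) — over a PERFECT extension `Ω ⊇ k` (used with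
   `Ω = perfectClosure k k̄`) the reduction `W = (X ⊗_k Ω)_red` is a reduced separated `Ω`-scheme of finite
   type, so the antecedent gives a resolution `π : Y → W` (Mathlib `Scheme.nilradical`, in-tree
   `isReduced_subscheme_nilradical` / `surjective_subschemeι_nilradical`).
2. `stub_descendResolutionData` (A₂, limit descent of the data) — for `Ω/k` algebraic, a proper `Y → X ⊗_k Ω`
   is the base change of a morphism `Y_K → X ⊗_k K` over a FINITE subextension `K` (Görtz–Wedhorn I 10.63/10.66,
   EGA IV₃ 8.8.2; in-tree `FiniteSubextensionDescent.closedSubscheme_descent` / `morphism_descent`).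
3. `stub_descendResolutionProps` (A₃, descent of the properties at that level, `Ω/k` purely inseparable) —
   `Y_K` is regular (faithfully flat descent, in-tree `IsRegularLocalRing.of_flat_of_isLocalHom`), `Y_K → X_K` is
   proper (fpqc descent, Mathlib `FlatDescent`) and factors through `Z = (X ⊗_k K)_red` birationally
   (`Spec Ω → Spec K` is a universal homeomorphism; the restriction over the dense open becomes a
   nil-immersion upstairs, hence is a closed immersion onto a reduced open downstairs, hence an isomorphism).
   So: `PerfectRes p` ⇒ `(X ⊗_k K)_red` HAS A RESOLUTION for some finite purely inseparable `K/k`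
   (Disproof §5, first half, typed and made a theorem).
4. `stub_towerInduction` (B+C) — a finite purely inseparable `K/k` is a tower of simple height-one steps
   `k_i ⊂ k_i(α)`, `α^p ∈ k_i`, `α ∉ k_i`; induction on `[K : k]` reduces descent of `HasResolution` along
   `(X ⊗_k K)_red → X` to the ONE-ROOT STEP (the inert steps of the card's C are absorbed: the step is stated
   for every reduced `X`, and `(X ⊗ k(α))_red → X` may well be birational).
5. `stub_oneRootStep` (F, THE CORE, mine) — for `a ∈ k ∖ k^p`, `K = k(a^{1/p})`: a resolution of
   `(X ⊗_k K)_red` yields a resolution of `X` (given `PerfectRes p`). Summit-implied; crux-complete modulo 1–4.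
   The card's engine for it: regularise the normalised Kummer cover `M[a^{1/p}]^ν` of a regular model `M` by
   blowing up `{ν ≥ 2}` — `stub_kummerCriterion` (D, the `ν ≤ 1` criterion = card first lemma) and
   `stub_constantQuotientRegular` (E, the quotient face: Disproof §8 REPAIRED lemma, p-closed nonsingular
   derivation ⇒ regular ring of constants) are its two typed tools, registered so that they land as lemmas.

Disproof.lean (v6.1) honoured: the antecedent is consumed (only) in stub A₁ (§2); no regular scheme is
base-changed along an inseparable extension hoping it stays regular — regularity is only DESCENDED along the
faithfully flat `Y → Y_K` (§3 p68332/p69541, §4 p69878); §10 `not_smoothModelAfterFGEnlargement` does not bite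
(K is purely inseparable OVER k, not a subfield of k, and smoothness is never claimed); §8/§9: E carries
`D^p = a·D` (p73820, p74285 separate the refuted lemma from E exactly there); §9 App. A (scheme-level `(★★)₂`
refuted for p ≥ 5) is why F is the WEAK one-root step, not simultaneous regularity.
-/

noncomputable section

set_option linter.dupNamespace false

open CategoryTheory CategoryTheory.Limits AlgebraicGeometry Polynomial
open Literature.AlgebraicGeometry.Resolution

namespace Summit.ResolutionOfSingularities.ResolutionOfSingularities.Cruxes.DescentPerfectToAll.Lines.RootOfAConstant

/-! ## The registered stubs (wave 1, 2026-08-16: A₁ A₂ A₃ B+C D E LANDED — p97850 p99203 p105404 p102084 p104053 p105688;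
open: F = `stub_oneRootStep`) -/

/-- STUB A₁ (antecedent consumer): over a perfect extension `Ω ⊇ k` of characteristic `p`, the reduction of
`X ⊗_k Ω` (a reduced closed subscheme with full support) is a reduced separated `Ω`-scheme of finite type, so
`PerfectRes p` resolves it. [folklore] -/
theorem stub_perfectBaseResolution : ∀ (p : ℕ) [Fact p.Prime], (∀ (κ : Type) [Field κ] [CharP κ p] [PerfectField κ] (Z : Scheme.{0}) (h : Z ⟶ Spec (.of κ)), IsSeparated h → LocallyOfFiniteType h → QuasiCompact h → IsReduced Z → Scheme.HasResolution Z) → ∀ (k Ω : Type) [Field k] [CharP k p] [Field Ω] [Algebra k Ω] [CharP Ω p] [PerfectField Ω] (X : Scheme.{0}) (f : X ⟶ Spec (.of k)), IsSeparated f → LocallyOfFiniteType f → QuasiCompact f → ∃ (W : Scheme.{0}) (ι : W ⟶ pullback f (Spec.map (CommRingCat.ofHom (algebraMap k Ω)))), IsClosedImmersion ι ∧ Surjective ι ∧ IsReduced W ∧ Scheme.HasResolution W :=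
  Summit.ResolutionOfSingularities.ResolutionOfSingularities.Theorems.stub_perfectBaseResolution  -- LANDED p97850

/-- STUB A₂ (limit descent of the data, Görtz–Wedhorn I, Thm. 10.63/10.66; EGA IV₃ 8.8.2): for an algebraic
extension `Ω/k` and a separated `k`-scheme of finite type `X`, every proper `g : Y → X ⊗_k Ω` is the base
change, along the transition map `t : X ⊗_k Ω → X ⊗_k K`, of a PROPER morphism `g_K : Y_K → X ⊗_k K` over a
subextension `K ⊆ Ω` FINITE over `k` (properness at the finite level: separated and of finite type by construction —
`Y_K` is a closed subscheme of a separated model — and universally closed by fpqc descent, Mathlib `FlatDescent`).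
[cite: GortzWedhorn2020, Thm. 10.63] -/
theorem stub_descendResolutionData : ∀ (k Ω : Type) [Field k] [Field Ω] [Algebra k Ω] [Algebra.IsAlgebraic k Ω] (X : Scheme.{0}) (f : X ⟶ Spec (.of k)), IsSeparated f → LocallyOfFiniteType f → QuasiCompact f → ∀ (Y : Scheme.{0}) (g : Y ⟶ pullback f (Spec.map (CommRingCat.ofHom (algebraMap k Ω)))), IsProper g → ∃ (K : IntermediateField k Ω) (_ : FiniteDimensional k K) (YK : Scheme.{0}) (gK : YK ⟶ pullback f (Spec.map (CommRingCat.ofHom (algebraMap k K)))) (e : Y ⟶ YK) (t : pullback f (Spec.map (CommRingCat.ofHom (algebraMap k Ω))) ⟶ pullback f (Spec.map (CommRingCat.ofHom (algebraMap k K)))), IsProper gK ∧ t ≫ pullback.fst f (Spec.map (CommRingCat.ofHom (algebraMap k K))) = pullback.fst f (Spec.map (CommRingCat.ofHom (algebraMap k Ω))) ∧ t ≫ pullback.snd f (Spec.map (CommRingCat.ofHom (algebraMap k K))) = pullback.snd f (Spec.map (CommRingCat.ofHom (algebraMap k Ω))) ≫ Spec.map (CommRingCat.ofHom (algebraMap K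 Ω)) ∧ IsPullback e g gK t :=
  Summit.ResolutionOfSingularities.ResolutionOfSingularities.Theorems.stub_descendResolutionData  -- LANDED p99203

/-- STUB A₃ (descent of the properties at a finite purely inseparable level): with `Ω/k` purely inseparable,
`W = (X ⊗_k Ω)_red`, a resolution `π : Y → W`, and a cartesian presentation `Y = Y_K ×_{X_K} X_Ω` of
`π ≫ ι_W` over a subextension `K`, the reduction `Z = (X ⊗_k K)_red` has a resolution (namely `Y_K → Z`:
regular by faithfully flat descent, proper by fpqc descent, birational because `X_Ω → X_K` is a universal
homeomorphism and a nil-immersion onto a reduced scheme is an isomorphism). [cite: EGAIV2, Prop. 6.5.1] -/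
theorem stub_descendResolutionProps : ∀ (k Ω : Type) [Field k] [Field Ω] [Algebra k Ω] [IsPurelyInseparable k Ω] (K : IntermediateField k Ω) (X : Scheme.{0}) (f : X ⟶ Spec (.of k)), IsSeparated f → LocallyOfFiniteType f → QuasiCompact f → ∀ (W : Scheme.{0}) (ιW : W ⟶ pullback f (Spec.map (CommRingCat.ofHom (algebraMap k Ω)))), IsClosedImmersion ιW → Surjective ιW → IsReduced W → ∀ (Y : Scheme.{0}) (π : Y ⟶ W), IsResolution π → ∀ (YK : Scheme.{0}) (gK : YK ⟶ pullback f (Spec.map (CommRingCat.ofHom (algebraMap k K)))) (e : Y ⟶ YK) (t : pullback f (Spec.map (CommRingCat.ofHom (algebraMap k Ω))) ⟶ pullback f (Spec.map (CommRingCat.ofHom (algebraMap k K)))), IsProper gK → t ≫ pullback.fst f (Spec.map (CommRingCat.ofHom (algebraMap k K))) = pullback.fst f (Spec.map (CommRingCat.ofHom (algebraMap k Ω))) → t ≫ pullback.snd f (Spec.map (CommRingCat.ofHom (algebraMap k K))) = pullback.snd f (Spec.map (CommRingCat.ofHom (algebraMap k Ω))) ≫ Spec.map (CommRingCat.ofHom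 (algebraMap K Ω)) → IsPullback e (π ≫ ιW) gK t → ∃ (Z : Scheme.{0}) (ιZ : Z ⟶ pullback f (Spec.map (CommRingCat.ofHom (algebraMap k K)))), IsClosedImmersion ιZ ∧ Surjective ιZ ∧ IsReduced Z ∧ Scheme.HasResolution Z :=
  Summit.ResolutionOfSingularities.ResolutionOfSingularities.Theorems.stub_descendResolutionProps  -- LANDED p105404

/-- STUB B+C (tower induction): a finite purely inseparable extension is a tower of simple height-one radicial
steps `k_i ⊂ k_i(α)`, `α^p ∈ k_i ∖ k_i^p`; hence descent of `HasResolution` along `(X ⊗_k K)_red → X` for all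
finite purely inseparable `K/k` follows from the one-root step (induction on `[K : k]`, passing through
`((X ⊗_k k(α))_red ⊗_{k(α)} K)_red = (X ⊗_k K)_red`). [folklore] -/
theorem stub_towerInduction : ∀ (p : ℕ) [Fact p.Prime], (∀ (k K : Type) [Field k] [Field K] [Algebra k K] [CharP k p] (a : k) (α : K), (∀ b : k, b ^ p ≠ a) → α ^ p = algebraMap k K a → IntermediateField.adjoin k {α} = ⊤ → ∀ (X : Scheme.{0}) (f : X ⟶ Spec (.of k)), IsSeparated f → LocallyOfFiniteType f → QuasiCompact f → IsReduced X → ∀ (Z : Scheme.{0}) (ι : Z ⟶ pullback f (Spec.map (CommRingCat.ofHom (algebraMap k K)))), IsClosedImmersion ι → Surjective ι → IsReduced Z → Scheme.HasResolution Z → Scheme.HasResolution X) → ∀ (k K : Type) [Field k] [Field K] [Algebra k K] [CharP k p] [FiniteDimensional k K] [IsPurelyInseparable k K] (X : Scheme.{0}) (f : X ⟶ Spec (.of k)), IsSeparated f → LocallyOfFiniteType f → QuasiCompact f → IsReduced X → ∀ (Z : Scheme.{0}) (ι : Z ⟶ pullback f (Spec.map (CommRingCat.ofHom (algebraMap k K)))),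 IsClosedImmersion ι → Surjective ι → IsReduced Z → Scheme.HasResolution Z → Scheme.HasResolution X :=
  Summit.ResolutionOfSingularities.ResolutionOfSingularities.Theorems.stub_towerInduction  -- LANDED p102084

/-- STUB D (tool for F — the card's first lemma, Kummer criterion): for a regular local ring `O` of
characteristic `p` and `a ∈ O`, the degree-`p` cover `O[T]/(T^p − a)` is a regular local ring iff `a` is not a
`p`-th power modulo `𝔪²` (`ν(a) ≤ 1`); this defines the bad locus `{ν ≥ 2}` of the one-root step.
[folklore] -/
theorem stub_kummerCriterion : ∀ (p : ℕ) [Fact p.Prime] (O : Type) [CommRing O] [IsRegularLocalRing O] [CharP O p] (a : O), IsRegularLocalRing (AdjoinRoot (X ^ p - C a : O[X])) ↔ ∀ c : O, a - c ^ p ∉ (IsLocalRing.maximalIdeal O) ^ 2 :=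
  Summit.ResolutionOfSingularities.ResolutionOfSingularities.Theorems.stub_kummerCriterion  -- LANDED p104053

/-- STUB E (tool for F — the quotient face; Disproof §8 REPAIRED lemma `InvariantsRegularOfPClosedNonsingularDerivation`,
Aramova–Avramov with the p-closedness hypothesis): the ring of constants of a p-closed derivation with a unit value
on a regular local ring of characteristic `p`, over which the ring is module-finite, is a regular local ring
(rescale to `D x = 1`, then `D^p = 0`; char-`p` Taylor expansion makes `R` free over `S` on `1, x, …, x^{p-1}`;
faithfully flat descent of regularity). [folklore] -/
theorem stub_constantQuotientRegular : ∀ (p : ℕ) [Fact p.Prime] (R : Type) [CommRing R] [IsRegularLocalRing R] [CharP R p] (D : Derivation ℤ R R) (S : Subring R), (∀ x : R, x ∈ S ↔ D x = 0) → Module.Finite S R → (∃ a : R, ∀ x : R, (⇑D)^[p] x = a * D x) → (∃ x : R, IsUnit (D x)) → IsRegularLocalRing S :=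
  Summit.ResolutionOfSingularities.ResolutionOfSingularities.Theorems.stub_constantQuotientRegular  -- LANDED p105688

/-! ### RESHAPE 1 (lead, 2026-08-16, after wave 1): the core F split at the skeleton level

`stub_oneRootStep` (F, registered 10:40Z) is now DERIVED (`oneRootStep` below) from three registered stubs:
* `stub_oneRootReduceToIntegral` (R1) — the one-root step for INTEGRAL `X` gives it for reduced `X` (irreducible
  components: `Z` and `X` are homeomorphic, a resolution of `Z` restricts to one of each component of `Z` because the
  components of a regular scheme are its connected components; reassemble with in-tree
  `hasResolution_of_irreducibleComponents`);
* `stub_oneRootReduceToGeomIntegral` (R2) — for integral `X` either `a ∈ k(X)^p`, and then `Z = (X ⊗_k K)_red → X`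
  is FINITE BIRATIONAL (over an affine open `Spec A ∋ β`, `β^p = a`: `(A[T]/(T − β)^p)_red = A`), so a resolution of
  `Z` composed with it resolves `X` (the card's inert step C); or `a ∉ k(X)^p`, and then `X ⊗_k K` is INTEGRAL
  (`𝒪(U) ⊗_k K ⊆ k(X) ⊗_k K`, a field) and `Z ≅ X ⊗_k K`;
* `stub_oneRootStepCore` (F′, THE CORE, mine) — the one-root step for integral `X` with `X ⊗_k K` integral:
  `HasResolution (X ⊗_k K) → HasResolution X`. Summit-implied, crux-complete; no proof known in print.
Tool stub (orphan, like D/E): `stub_oneRootNormalization` (R3) — WLOG `X` NORMAL in F′ (normalisation is finite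
birational; a resolution of `X ⊗_k K` lifts to the finite birational `X^ν ⊗_k K → X ⊗_k K` because regular schemes are
normal and the normalisation of `X ⊗_k K` dominates every finite birational model). -/

/-- STUB R1 (reduction to integral `X`): the one-root step for integral schemes implies it for reduced schemes
(irreducible components with their reduced structure; the components of the regular source of a resolution are open).
[folklore] -/
theorem stub_oneRootReduceToIntegral : ∀ (p : ℕ) [Fact p.Prime], (∀ (k K : Type) [Field k] [Field K] [Algebra k K] [CharP k p] (a : k) (α : K), (∀ b : k, b ^ p ≠ a) → α ^ p = algebraMap k K a → IntermediateField.adjoin k {α} = ⊤ → ∀ (X : Scheme.{0}) (f : X ⟶ Spec (.of k)), IsSeparated f → LocallyOfFiniteType f → QuasiCompact f → IsIntegral X → ∀ (Z : Scheme.{0}) (ι : Z ⟶ pullback f (Spec.map (CommRingCat.ofHom (algebraMap k K)))), IsClosedImmersion ι → Surjective ι → IsReduced Z → Scheme.HasResolution Z → Scheme.HasResolution X) → (∀ (k K : Type) [Field k] [Field K] [Algebra k K] [CharP k p] (a : k) (α : K), (∀ b : k, b ^ p ≠ a) → α ^ p = algebraMap k K a → IntermediateField.adjoin k {α} = ⊤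 → ∀ (X : Scheme.{0}) (f : X ⟶ Spec (.of k)), IsSeparated f → LocallyOfFiniteType f → QuasiCompact f → IsReduced X → ∀ (Z : Scheme.{0}) (ι : Z ⟶ pullback f (Spec.map (CommRingCat.ofHom (algebraMap k K)))), IsClosedImmersion ι → Surjective ι → IsReduced Z → Scheme.HasResolution Z → Scheme.HasResolution X) :=
  Summit.ResolutionOfSingularities.ResolutionOfSingularities.Theorems.stub_oneRootReduceToIntegral  -- LANDED p107667

/-- STUB R2 (reduction to geometrically integral `X` along `K`): for integral `X`, either `a` is a `p`-th power in the
function field — then `(X ⊗_k K)_red → X` is finite birational and a resolution of it resolves `X` — or not — then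
`X ⊗_k K` is integral and equals its reduction. [folklore] -/
theorem stub_oneRootReduceToGeomIntegral : ∀ (p : ℕ) [Fact p.Prime], (∀ (k K : Type) [Field k] [Field K] [Algebra k K] [CharP k p] (a : k) (α : K), (∀ b : k, b ^ p ≠ a) → α ^ p = algebraMap k K a → IntermediateField.adjoin k {α} = ⊤ → ∀ (X : Scheme.{0}) (f : X ⟶ Spec (.of k)), IsSeparated f → LocallyOfFiniteType f → QuasiCompact f → IsIntegral X → IsIntegral (pullback f (Spec.map (CommRingCat.ofHom (algebraMap k K)))) → Scheme.HasResolution (pullback f (Spec.map (CommRingCat.ofHom (algebraMap k K)))) → Scheme.HasResolution X) → (∀ (k K : Type) [Field k] [Field K] [Algebra k K] [CharP k p] (a : k) (α : K), (∀ b : k, b ^ p ≠ a) → α ^ p = algebraMap k K a → IntermediateField.adjoin k {α} = ⊤ → ∀ (X : Scheme.{0}) (f : X ⟶ Spec (.of k)), IsSeparated f → LocallyOfFiniteType f → QuasiCompact f → IsIntegral X → ∀ (Z : Scheme.{0}) (ι : Z ⟶ pullback f (Spec.map (CommRingCat.ofHom (algebraMap k K)))), IsClosedImmersion ι → Surjective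 ι → IsReduced Z → Scheme.HasResolution Z → Scheme.HasResolution X) :=
  Summit.ResolutionOfSingularities.ResolutionOfSingularities.Theorems.stub_oneRootReduceToGeomIntegral  -- LANDED p108841

/-- STUB R3 (tool for F′ — WLOG normal): the one-root core for NORMAL integral `X` implies it for integral `X`
(normalisation `X^ν → X` is finite birational, E. Noether; a resolution `Y → X ⊗_k K` lifts along the finite
birational `X^ν ⊗_k K → X ⊗_k K` since `Y` is normal). [folklore] -/
theorem stub_oneRootNormalization : ∀ (p : ℕ) [Fact p.Prime], (∀ (k K : Type) [Field k] [Field K] [Algebra k K] [CharP k p] (a : k) (α : K), (∀ b : k, b ^ p ≠ a) → α ^ p = algebraMap k K a → IntermediateField.adjoin k {α} = ⊤ → ∀ (X : Scheme.{0}) (f : X ⟶ Spec (.of k)), IsSeparated f → LocallyOfFiniteType f → QuasiCompact f → IsIntegral X → (∀ x : X, IsIntegrallyClosed (X.presheaf.stalk x)) → IsIntegral (pullback f (Spec.map (CommRingCat.ofHom (algebraMap k K)))) → Scheme.HasResolution (pullback f (Spec.map (CommRingCat.ofHom (algebraMap k K)))) → Scheme.HasResolution X) → (∀ (k K : Type)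 [Field k] [Field K] [Algebra k K] [CharP k p] (a : k) (α : K), (∀ b : k, b ^ p ≠ a) → α ^ p = algebraMap k K a → IntermediateField.adjoin k {α} = ⊤ → ∀ (X : Scheme.{0}) (f : X ⟶ Spec (.of k)), IsSeparated f → LocallyOfFiniteType f → QuasiCompact f → IsIntegral X → IsIntegral (pullback f (Spec.map (CommRingCat.ofHom (algebraMap k K)))) → Scheme.HasResolution (pullback f (Spec.map (CommRingCat.ofHom (algebraMap k K)))) → Scheme.HasResolution X) :=
  Summit.ResolutionOfSingularities.ResolutionOfSingularities.Theorems.stub_oneRootNormalization  -- LANDED p112741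

/-! ### RESHAPE 2 (lead, 2026-08-16, after wave 2: R1 p107667, R2 p108841, R3 p112741 LANDED): the core is
sharpened to NORMAL `X` — `stub_oneRootStepCore` (F′, registered 13:45Z) is now glue `R3 ∘ F″`, and the one open
stub of the line is `stub_oneRootStepCoreNormal` (F″). -/

/-- STUB F″ (THE CORE, the line's one open stub — the one-root-of-a-constant step in its essential case; Temkin 2008,
Question 3.3.3 in its smallest instance): assume resolution over all perfect fields of characteristic `p`; let
`a ∈ k ∖ k^p`, `K = k(α)`, `α^p = a`, and `X` a NORMAL integral separated `k`-scheme of finite type with `X ⊗_k K`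
integral (i.e. `a ∉ k(X)^p`). If `X ⊗_k K` has a resolution, then `X` has a resolution. Summit-implied and
crux-complete: `DescentPerfectToAll` ⟺ this statement given the nine landed stubs
(`Theorems/WeightedInvariantDescentPerfectToAllOneRootCoreReduction.lean`). No proof is known in print. Card engine for
an attack: regularise the normalised constant Kummer cover `M[a^{1/p}]^ν` of a regular model `M → X` by blowing up
the closed bad locus `{ν ≥ 2}` (tool D `stub_kummerCriterion`: the cover is regular exactly where `a` is not a `p`-th
power mod `𝔪²`); quotient face: smooth the p-closed constant foliation `∂/∂α` and take constants (tool E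
`stub_constantQuotientRegular`); multiplicative 𝔽_p-resonant ends need weighted (stacky) blow-ups (card (3b),
Posva/Tziolas) — no tree language; scheme-level simultaneous regularity `(★★)₂` is refuted for p ≥ 5 (TRIAGE-r1-1
App. A), so any proof must let the regular model of `X` and the regular model of `X ⊗_k K` differ. -/
theorem stub_oneRootStepCoreNormal : ∀ (p : ℕ) [Fact p.Prime], (∀ (κ : Type) [Field κ] [CharP κ p] [PerfectField κ] (Z : Scheme.{0}) (h : Z ⟶ Spec (.of κ)), IsSeparated h → LocallyOfFiniteType h → QuasiCompact h → IsReduced Z → Scheme.HasResolution Z) → (∀ (k K : Type) [Field k] [Field K] [Algebra k K] [CharP k p] (a : k) (α : K), (∀ b : k, b ^ p ≠ a) → α ^ p = algebraMap k K a → IntermediateField.adjoin k {α} = ⊤ → ∀ (X : Scheme.{0}) (f : X ⟶ Spec (.of k)), IsSeparated f → LocallyOfFiniteType f → QuasiCompact f → IsIntegral X → (∀ x : X, IsIntegrallyClosed (X.presheaf.stalk x)) → IsIntegral (pullback f (Spec.map (CommRingCat.ofHom (algebraMap k K)))) → Scheme.HasResolution (pullback f (Spec.map (CommRingCat.ofHom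 (algebraMap k K)))) → Scheme.HasResolution X) := by
  sorry

/-- F′ (the registered `stub_oneRootStepCore` of 13:45Z), now glue: WLOG `X` normal (R3 `stub_oneRootNormalization`,
LANDED p112741) applied to F″. Originally: STUB F′ (THE CORE — the one-root-of-a-constant step in its essential case; Temkin 2008, Question 3.3.3 in its
smallest instance): assume resolution over all perfect fields of characteristic `p`; let `a ∈ k ∖ k^p`, `K = k(α)`,
`α^p = a`, and `X` an integral separated `k`-scheme of finite type with `X ⊗_k K` integral (i.e. `a ∉ k(X)^p`). If
`X ⊗_k K` has a resolution, then `X` has a resolution. Summit-implied; crux-complete given the landed stubs. (Card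
engine: regularise the normalised constant Kummer cover of a regular model by blowing up `{ν ≥ 2}` — tools D, E, R3.) -/
theorem stub_oneRootStepCore : ∀ (p : ℕ) [Fact p.Prime], (∀ (κ : Type) [Field κ] [CharP κ p] [PerfectField κ] (Z : Scheme.{0}) (h : Z ⟶ Spec (.of κ)), IsSeparated h → LocallyOfFiniteType h → QuasiCompact h → IsReduced Z → Scheme.HasResolution Z) → (∀ (k K : Type) [Field k] [Field K] [Algebra k K] [CharP k p] (a : k) (α : K), (∀ b : k, b ^ p ≠ a) → α ^ p = algebraMap k K a → IntermediateField.adjoin k {α} = ⊤ → ∀ (X : Scheme.{0}) (f : X ⟶ Spec (.of k)), IsSeparated f → LocallyOfFiniteType f → QuasiCompact f → IsIntegral X → IsIntegral (pullback f (Spec.map (CommRingCat.ofHom (algebraMap k K)))) → Scheme.HasResolution (pullback f (Spec.map (CommRingCat.ofHom (algebraMap k K)))) → Scheme.HasResolution X) :=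
  fun p _ H => stub_oneRootNormalization p (stub_oneRootStepCoreNormal p H)

/-- F (the registered `stub_oneRootStep` of 10:40Z), now glue: R1 ∘ R2 ∘ F′. [folklore] -/
theorem oneRootStep : ∀ (p : ℕ) [Fact p.Prime], (∀ (κ : Type) [Field κ] [CharP κ p] [PerfectField κ] (Z : Scheme.{0}) (h : Z ⟶ Spec (.of κ)), IsSeparated h → LocallyOfFiniteType h → QuasiCompact h → IsReduced Z → Scheme.HasResolution Z) → (∀ (k K : Type) [Field k] [Field K] [Algebra k K] [CharP k p] (a : k) (α : K), (∀ b : k, b ^ p ≠ a) → α ^ p = algebraMap k K a → IntermediateField.adjoin k {α} = ⊤ → ∀ (X : Scheme.{0}) (f : X ⟶ Spec (.of k)), IsSeparated f → LocallyOfFiniteType f → QuasiCompact f → IsReduced X → ∀ (Z : Scheme.{0}) (ι : Z ⟶ pullback f (Spec.map (CommRingCat.ofHom (algebraMap k K)))), IsClosedImmersion ι → Surjective ι → IsReduced Z → Scheme.HasResolution Z → Scheme.HasResolution X) :=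
  fun p _ H => stub_oneRootReduceToIntegral p (stub_oneRootReduceToGeomIntegral p (stub_oneRootStepCore p H))

/-! ## Composition -/

/-- The line closes the crux modulo its stubs: `DescentPerfectToAll` (route WeightedInvariant's copy, by name).
[folklore] -/
theorem DescentPerfectToAll_of :
    Summit.ResolutionOfSingularities.ResolutionOfSingularities.Theses.WeightedInvariant.DescentPerfectToAll := by
  intro p hp H k _ _ X f hsep hlft hqc hred
  haveI : Fact p.Prime := ⟨hp⟩
  -- the ambient perfect, purely inseparable extension: the perfect closure of `k` in an algebraic closure
  let Ω : Type := ↥(perfectClosure k (AlgebraicClosure k))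
  haveI : CharP Ω p := charP_of_injective_algebraMap (algebraMap k Ω).injective p
  -- A₁: resolve the reduction of `X ⊗_k Ω` by the antecedent
  obtain ⟨W, ιW, hcl, hsurj, hWred, Y, π, hπ⟩ := stub_perfectBaseResolution p H k Ω X f hsep hlft hqc
  haveI := hπ.isProper
  haveI := hcl
  have hg : IsProper (π ≫ ιW) := inferInstance
  -- A₂: descend the data to a finite level
  obtain ⟨K, hK, YK, gK, e, t, hgK, ht₁, ht₂, hsq⟩ :=
    stub_descendResolutionData k Ω X f hsep hlft hqc Y (π ≫ ιW) hg
  -- A₃: the reduction of `X ⊗_k K` has a resolution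
  obtain ⟨Z, ιZ, hZ₁, hZ₂, hZ₃, hZ₄⟩ :=
    stub_descendResolutionProps k Ω K X f hsep hlft hqc W ιW hcl hsurj hWred Y π hπ YK gK e t hgK ht₁ ht₂ hsq
  haveI : FiniteDimensional k K := hK
  -- B+C with F: descend along the finite purely inseparable `K/k`
  exact stub_towerInduction p (oneRootStep p H) k K X f hsep hlft hqc hred Z ιZ hZ₁ hZ₂ hZ₃ hZ₄

/-- The same proposition for route Descent (the three route decls are `rfl`-equal). [folklore] -/
theorem DescentPerfectToAll_of_descent :
    Summit.ResolutionOfSingularities.ResolutionOfSingularities.Theses.Descent.DescentPerfectToAll :=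
  DescentPerfectToAll_of

/- The same proposition for route UniformComplexity (`…Theses.UniformComplexity.DescentPerfectToAll`, rfl-equal to the two
above) is `DescentPerfectToAll_of` verbatim; its import is omitted in v7 so that the skeleton elaborates while that route file is
being edited (farm coherence), cf. tree v6 for the three-route form. -/

end Summit.ResolutionOfSingularities.ResolutionOfSingularities.Cruxes.DescentPerfectToAll.Lines.RootOfAConstant

end
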